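import Summits.MatrixMultiplication.MatrixMultiplication.Theorems.FarEdgeDescentConverseRigidityCore
import Summits.MatrixMultiplication.MatrixMultiplication.Theorems.FarEdgeDescentTwistedStarRigidity
import HarnessLib

/-!
# Far-edge descent — converse rigidity: `𝔖_n(L)^{⊠N}` is not a degeneration of `⟨n,n,2L⟩^{⊠N}`

Support file for route `FarEdgeDescent` (aside `SubLogRate`), kernel IV of the lineage
`decomp-mm-lens-2` («structural dichotomy, special vs generic»); cut of record (rev 13)
`FiniteSaturation ∧ AnchoredLogConvexity → MatrixMultiplication` UNCHANGED.

**Theorem.** For every field `K`, all `n ≥ 2`, `L ≥ 1`, `N ≥ 1`: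
`⟨n,n,2L⟩^{⊠N} ⋭ 𝔖_n(L)^{⊠N}` (`matMul_pow_not_algDegeneratesTo_twistedStar_pow`; in the tree's
convention `AlgDegeneratesTo s t` is `t ⊴ s`, so this reads: the coherent star does NOT degenerate to
the twisted star, `¬ (𝔖_n(L)^{⊠N} ⊴ ⟨n,n,2L⟩^{⊠N})`), where
`𝔖_n(L)` is the twisted star `(X, (Y, Y')) ↦ (XY, XᵀY')` and `⟨n,n,2L⟩ ≅ (X, (Y, Y')) ↦ (XY, XY')`
the coherent one.  Together with Kernel II (`twistedStar_pow_not_algDegeneratesTo`, the other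
direction, `2L ≤ n`) the two stars are **degeneration-incomparable at every finite level**
(`twistedStar_pow_incomparable`) although they have the same support functionals / quantum
functionals (Kernel III, `FarEdgeDescentQuantumTwin`): the asymptotic spectrum's known points do
not see the twist `ᵀ`, and neither finite-level degeneration order does the comparison.

**Proof.** The commutant obstruction (`FarEdgeDescentCommutantObstruction`): the slice pencil of
`⟨n,n,2L⟩^{⊠N}` (slices `Z ↦` "multiply by `X` in every factor") commutes with the `(2L)^{2N}`
linearly independent column-unit operators `unitMat r` acting on the leaf columns, while a pair
`(β, γ)` intertwining the slice pencil of `𝔖_n(L)^{⊠N}` has `β = γ` supported on pairs of indices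
with equal rows and equal leaf tags and depending only on tags and columns
(`FarEdgeDescentConverseRigidityCore.twisted_entry`): dimension `≤ 2^N L^{2N} < (2L)^{2N}`.
The twist is visible to the commutant because `X ↦ Xᵀ` is an ANTI-homomorphism: no operator can
move the `inl` leaf to the `inr` leaf compatibly with all `X`.

[cite: BurgisserClausenShokrollahi1997, (15.19)–(15.25); Strassen1988, §3; Blaser2013, §5]
-/

noncomputable section

open scoped BigOperators

set_option linter.dupNamespace false

namespace Summit.MatrixMultiplication.MatrixMultiplication.Theorems.FarEdgeDescentConverseRigidity

open Literature.Computability.AlgebraicComplexity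
open Summit.MatrixMultiplication.MatrixMultiplication.Theorems.FarEdgeDescentCommutantObstruction
open Summit.MatrixMultiplication.MatrixMultiplication.Theorems.FarEdgeDescentTwistedStar
open Summit.MatrixMultiplication.MatrixMultiplication.Theorems.FarEdgeDescentPairingObstruction

variable {K : Type*} [Field K] {n L N : ℕ}

/-! ## The coherent side: many commuting operators -/

/-- The column-unit operator `unitMat (r₁, r₂)`: on leaf indices it keeps every row and maps the
column pattern `r₁` to the column pattern `r₂` (entry `1` at `(u, z)` iff `u`, `z` have the same rows,
`z` has columns `r₁` and `u` has columns `r₂`). [folklore] -/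
def unitMat (r : (Fin N → Fin L ⊕ Fin L) × (Fin N → Fin L ⊕ Fin L)) :
    Matrix (Fin N → Fin n × (Fin L ⊕ Fin L)) (Fin N → Fin n × (Fin L ⊕ Fin L)) K :=
  Matrix.of fun u z =>
    if (∀ i, (u i).1 = (z i).1) ∧ ((fun i => (z i).2), (fun i => (u i).2)) = r then 1 else 0

/-- Column-unit operators commute with every slice of `⟨n,n,2L⟩^{⊠N}` (the slices act on rows
only). [folklore] -/
theorem unitMat_comm (r : (Fin N → Fin L ⊕ Fin L) × (Fin N → Fin L ⊕ Fin L))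
    (b : Fin N → Fin n × Fin n) :
    unitMat (K := K) r *
        slice (kroneckerPow (routed (R := K) (fun (_ : Fin L ⊕ Fin L) (b : Fin n × Fin n) => b.1)
          (fun _ b => b.2)) N) b =
      slice (kroneckerPow (routed (R := K) (fun (_ : Fin L ⊕ Fin L) (b : Fin n × Fin n) => b.1)
          (fun _ b => b.2)) N) b * unitMat (K := K) r := by
  refine Matrix.ext fun u w => ?_
  rw [mul_slicePow_apply, slicePow_mul_apply]
  simp only [unitMat, Matrix.of_apply]
  by_cases h₁ : ∀ i, (b i).2 = (w i).1 <;> by_cases h₂ : ∀ i, (u i).1 = (b i).1 <;> simp [h₁, h₂]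

/-- The column-unit operators are linearly independent (`unitMat r` is the only one with a nonzero
entry at (rows `0`, columns `r₂`) × (rows `0`, columns `r₁`)). [folklore] -/
theorem unitMat_linearIndependent (hn : 2 ≤ n) :
    LinearIndependent K (unitMat (K := K) (n := n) (L := L) (N := N)) := by
  rw [Fintype.linearIndependent_iff]
  intro g hg r
  have h := congr_fun (congr_fun hg (fun i => ((⟨0, by omega⟩ : Fin n), r.2 i)))
    (fun i => ((⟨0, by omega⟩ : Fin n), r.1 i))
  rw [Matrix.sum_apply, Matrix.zero_apply] at h
  have hval : ∀ x : (Fin N → Fin L ⊕ Fin L) × (Fin N → Fin L ⊕ Fin L),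
      (g x • unitMat (K := K) x) (fun i => ((⟨0, by omega⟩ : Fin n), r.2 i))
        (fun i => ((⟨0, by omega⟩ : Fin n), r.1 i)) = if r = x then g x else 0 := by
    intro x
    rw [Matrix.smul_apply, smul_eq_mul]
    simp only [unitMat, Matrix.of_apply]
    split_ifs with hc hx hx
    · exact mul_one _
    · exact absurd hc.2 hx
    · exact absurd ⟨fun _ => trivial, hx⟩ hc
    · exact mul_zero _
  simp only [hval, Finset.sum_ite_eq, Finset.mem_univ, if_true] at h
  exact h

/-! ## Counting -/

/-- `2^N · L^N · L^N < (2L)^N · (2L)^N` for `N ≥ 1`, `L ≥ 1`. [folklore] -/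
theorem card_param_lt (hL : 1 ≤ L) (hN : 1 ≤ N) :
    Fintype.card ((Fin N → Bool) × (Fin N → Fin L) × (Fin N → Fin L)) <
      Fintype.card ((Fin N → Fin L ⊕ Fin L) × (Fin N → Fin L ⊕ Fin L)) := by
  simp only [Fintype.card_prod, Fintype.card_fun, Fintype.card_bool, Fintype.card_fin,
    Fintype.card_sum]
  have hLN : 0 < L ^ N * L ^ N := by positivity
  have h2 : 1 < 2 ^ N := Nat.one_lt_two_pow (by omega)
  have hre : (L + L) ^ N * (L + L) ^ N = 2 ^ N * (2 ^ N * (L ^ N * L ^ N)) := by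
    rw [← two_mul, mul_pow]; ring
  rw [hre]
  exact Nat.mul_lt_mul_of_pos_left (lt_mul_of_one_lt_left hLN h2) (by positivity)

/-! ## The theorems -/

/-- The leaf-coordinate form: `cohLeaf^{⊠N} ⋭ twiLeaf^{⊠N}` (`n ≥ 2`, `L ≥ 1`, `N ≥ 1`), by the
commutant obstruction with the column-unit operators on the coherent side and the entry
classification `twisted_entry` on the twisted side. [cite: BurgisserClausenShokrollahi1997, (15.19)] -/
theorem leafPow_not_algDegeneratesTo (hn : 2 ≤ n) (hL : 1 ≤ L) (hN : 1 ≤ N) :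
    ¬ AlgDegeneratesTo (kroneckerPow (cohLeaf K n L) N) (kroneckerPow (twiLeaf K n L) N) := by
  classical
  rw [cohLeaf_eq_routed, twiLeaf_eq_routed]
  refine not_algDegeneratesTo_of_commutant
    (R₀ := (Fin N → Fin L ⊕ Fin L) × (Fin N → Fin L ⊕ Fin L))
    (kroneckerPow (routed (R := K) (fun (_ : Fin L ⊕ Fin L) (b : Fin n × Fin n) => b.1)
      (fun _ b => b.2)) N)
    (kroneckerPow (routed (R := K) pick copick) N) unitMat unitMat (fun r b => unitMat_comm r b)
    (unitMat_linearIndependent hn)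
    (LinearMap.range ((paramMap (K := K) (n := n) (L := L) (N := N)).prod paramMap)) ?_ ?_
  · intro β' γ' h
    have hp : ∀ (s : Fin L ⊕ Fin L) (a : Fin n), pick s (a, a) = a := fun s a => by
      cases s <;> rfl
    have hc : ∀ (s : Fin L ⊕ Fin L) (a : Fin n), copick s (a, a) = a := fun s a => by
      cases s <;> rfl
    have heq : β' = γ' := commutant_fst_eq_snd pick copick hp hc β' γ' h
    subst heq
    obtain ⟨g, hg⟩ := twisted_mem_range hn β' h
    exact ⟨g, Prod.ext hg hg⟩
  · calc Module.finrank K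
          (LinearMap.range ((paramMap (K := K) (n := n) (L := L) (N := N)).prod paramMap))
        ≤ Module.finrank K (((Fin N → Bool) × (Fin N → Fin L) × (Fin N → Fin L)) → K) :=
          LinearMap.finrank_range_le _
      _ = Fintype.card ((Fin N → Bool) × (Fin N → Fin L) × (Fin N → Fin L)) :=
          Module.finrank_fintype_fun_eq_card K
      _ < Fintype.card ((Fin N → Fin L ⊕ Fin L) × (Fin N → Fin L ⊕ Fin L)) := card_param_lt hL hN

/-- **`𝔖_n(L)^{⊠N}` is not a degeneration of `⟨n,n,2L⟩^{⊠N}`** (`¬ (𝔖^{⊠N} ⊴ ⟨n,n,2L⟩^{⊠N})`;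
`n ≥ 2`, `L ≥ 1`, `N ≥ 1`, any field): the converse of Kernel II.  Transpose UN-cashing is false at
every finite level: `N` simultaneous coherent stars never degenerate to `N` simultaneous twisted
stars of the same size.
[cite: BurgisserClausenShokrollahi1997, (15.19), (15.25)] -/
theorem matMul_pow_not_algDegeneratesTo_twistedStar_pow (n L N : ℕ) (hn : 2 ≤ n) (hL : 1 ≤ L)
    (hN : 1 ≤ N) :
    ¬ AlgDegeneratesTo (kroneckerPow (matMulTensor K n n (L + L)) N)
      (kroneckerPow (twistedStar K n L) N) :=
  fun h => leafPow_not_algDegeneratesTo hn hL hN (algDegeneratesTo_leaf h)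

/-- **`𝔖_n(L)` is not a degeneration of `⟨n,n,2L⟩`** (single copy, `n ≥ 2`, `L ≥ 1`). [cite: BurgisserClausenShokrollahi1997, (15.19)] -/
theorem matMul_not_algDegeneratesTo_twistedStar (n L : ℕ) (hn : 2 ≤ n) (hL : 1 ≤ L) :
    ¬ AlgDegeneratesTo (matMulTensor K n n (L + L)) (twistedStar K n L) :=
  fun h => matMul_pow_not_algDegeneratesTo_twistedStar_pow n L 1 hn hL le_rfl (h.kroneckerPow 1)

/-- **No power of `⟨n,n,2L⟩` restricts to the same power of `𝔖_n(L)`** (restriction is order-`0`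
degeneration). [cite: BurgisserClausenShokrollahi1997, (15.20)] -/
theorem matMul_pow_not_restrictsTo_twistedStar_pow (n L N : ℕ) (hn : 2 ≤ n) (hL : 1 ≤ L)
    (hN : 1 ≤ N) :
    ¬ TensorRestrictsTo (kroneckerPow (matMulTensor K n n (L + L)) N)
      (kroneckerPow (twistedStar K n L) N) :=
  fun h => matMul_pow_not_algDegeneratesTo_twistedStar_pow n L N hn hL hN h.algDegeneratesTo

/-- **Degeneration-incomparability of the quantum twins at every finite level.**  For `1 ≤ L`,
`2L ≤ n`, `N ≥ 1` and any field: neither of `𝔖_n(L)^{⊠N}`, `⟨n,n,2L⟩^{⊠N}` degenerates to the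
other (Kernel II: alternating self-pairing; Kernel IV: slice commutant), although all their
quantum functionals agree (Kernel III). [cite: BurgisserClausenShokrollahi1997, (15.19), (15.25)] -/
theorem twistedStar_pow_incomparable (n L N : ℕ) (hL : 1 ≤ L) (h2 : L + L ≤ n) (hN : 1 ≤ N) :
    ¬ AlgDegeneratesTo (kroneckerPow (twistedStar K n L) N)
        (kroneckerPow (matMulTensor K n n (L + L)) N) ∧
      ¬ AlgDegeneratesTo (kroneckerPow (matMulTensor K n n (L + L)) N)
        (kroneckerPow (twistedStar K n L) N) :=
  ⟨twistedStar_pow_not_algDegeneratesTo n L N hL h2 hN,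
    matMul_pow_not_algDegeneratesTo_twistedStar_pow n L N (by omega) hL hN⟩

/-- The far-edge instance `L = 1`: for every `n ≥ 2` and `N ≥ 1`, `𝔖_n(1)^{⊠N}`
(`(x, (y, y')) ↦ (Xy, Xᵀy')`, `N`-fold) and `⟨n,n,2⟩^{⊠N}` are degeneration-incomparable. [cite: BurgisserClausenShokrollahi1997, (15.19)] -/
theorem twistedStar_one_pow_incomparable (n N : ℕ) (hn : 2 ≤ n) (hN : 1 ≤ N) :
    ¬ AlgDegeneratesTo (kroneckerPow (twistedStar K n 1) N) (kroneckerPow (matMulTensor K n n 2) N) ∧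
      ¬ AlgDegeneratesTo (kroneckerPow (matMulTensor K n n 2) N) (kroneckerPow (twistedStar K n 1) N) :=
  twistedStar_pow_incomparable n 1 N le_rfl hn hN

end Summit.MatrixMultiplication.MatrixMultiplication.Theorems.FarEdgeDescentConverseRigidity

end
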